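import Summits.Parity.GeneralizedHardyLittlewood.Theorems.FordMaynardSieveConst01651SieveConst01651StarSplit
import Summits.Parity.GeneralizedHardyLittlewood.Theorems.FordMaynardSieveConst01651SieveConst01651HkPieces
import Summits.Parity.GeneralizedHardyLittlewood.Theorems.FordMaynardSieveConst01651SieveConst01651ChamberSymm
import HarnessLib

/-!
# Route `FordMaynardSieveConst01651`, target `SieveConst01651` (stmt-Parity-19185), line `sieve_decomposition`,
# stub `stub_coneCertClosed`: the kernel normal form of the certificate value `sieveBoundG1 ν g`

Helper file (def-free), continuation of `…SliceKernel` / `…StarSplit` (K. Ford, J. Maynard, *On the theory of prime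
producing sieves*, arXiv:2407.14368, Theorem 7.3 (a)).  For a SYMMETRIC `g` that is piecewise constant on the ordered
cone (`IsPiecewiseConstOnCone`, the class of the certificate), the `k`-th summand of
`V(ν, g) = sieveBoundG1 ν g = 1 + ∑_k ∫_{x ∈ ℋ_k, x₁ ≤ ⋯ ≤ x_k} (𝟙⋆g)(x)/(x₁⋯x_k)` is rewritten as

  `(1/k!) · ∑_{A ⊆ [k]} ∫_{|x| = 1} 𝟙[xᵢ > ν] g_{|A|}(x_A)/∏ xᵢ`

(`sieveBoundG1_eq_sum_subvector_terms`), and the inner terms are grouped by `r = |A|`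
(`sum_subvector_terms_card`: the `C(k,r)` terms with `|A| = r`, `1 ≤ r ≤ k−1`, all equal the ONE-dimensional integral
`∫_{t ∈ (0,1]} S_r(t) F_{k−r}(1−t) dt` of `…StarSplit`; `|A| = 0` gives `g(∅)·F_k(1)` by `sliceIntegral_empty_term`).
Ingredients proved here:

* `measurable_apply_of_cone`, `exists_abs_apply_le_upto` — measurability and bounds of each `g_r` (from the exact
  piece decomposition `apply_dim_pieces` of `…HkPieces`);
* `starSum_perm'` — `(𝟙⋆g)(x ∘ σ) = (𝟙⋆g)(x)` for symmetric `g`;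
* (from `…ChamberSymm`) `chamber_symm'` — `∫_{|u|=w} Φ = k! · ∫_{|u|=w} 𝟙[u monotone] Φ` for `Φ` measurable,
  bounded and permutation invariant;
* `upper_lt_of_box_slice` — on `|x| = 1` with `k ≥ 2` and all `xᵢ > ν > 0`, automatically `xᵢ < 1 − ν`
  (so `ℋ_k` is the box `xᵢ > ν` on the slice, Lemma 8.4).

`starSum_perm'` (with `apply_orderEmb_cast'`, `apply_comp_eq_of_range'`) is ADAPTED FROM the line-writer's
non-importable skeleton `Cruxes/SieveConst01651/Lines/sieve_decomposition.lean` (planner-linewriter-parity-smallroutes-1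
g0, v19, decl `starSum_perm`) so that Theorems files can import it.

References: [FordMaynard2024PrimeSieves] arXiv:2407.14368, Definition 7.1, Theorem 7.3 (a), Lemma 8.4, §4.2.
-/

noncomputable section

open MeasureTheory Set Finset
open scoped Classical
open Literature.NumberTheory.Sieve Literature.NumberTheory.Sieve.FordMaynard

namespace Summit.Parity.GeneralizedHardyLittlewood.FordMaynardSieveConst01651SieveConst01651

/-! ### Grouping the subvector terms by cardinality -/

/-- **The `C(k,r)` subvector terms with `|A| = r` (`1 ≤ r ≤ k−1`) are all the same one-dimensional kernel integral**:
`∑_{|A| = r} ∫_{|x|=w} 𝟙[xᵢ>ν] g_r(x_A)/∏ xᵢ = C(k,r) · ∫_{t ∈ (0,w]} S_r(t) · F_{k−r}(w−t) dt` with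
`S_r(t) = ∫_{|v|=t} 𝟙[vᵢ>ν] g_r(v)/∏ vᵢ`, `F_m(s) = ∫_{|u|=s} 𝟙[uⱼ>ν]/∏ uⱼ`.
[cite: FordMaynard2024PrimeSieves, Definition 7.1 and Theorem 7.3 (a)] -/
theorem sum_subvector_terms_card (k r : ℕ) (hr : 1 ≤ r) (hrk : r + 1 ≤ k) {ν : ℝ} (hν : 0 < ν) (w : ℝ)
    (g : VecFn) (hgm : Measurable (g r)) {C : ℝ} (hC : 0 ≤ C) (hgb : ∀ x, |g r x| ≤ C) :
    ∑ A ∈ Finset.powersetCard r (Finset.univ : Finset (Fin k)), sliceIntegral k w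
        (fun x => if ∀ i, ν < x i then g A.card (fun i => x (A.orderEmbOfFin rfl i)) / ∏ i, x i else 0) =
      (k.choose r : ℝ) * ∫ t in Set.Ioc 0 w,
        sliceIntegral r t (fun v => if ∀ i, ν < v i then g r v / ∏ i, v i else 0) *
          sliceIntegral (k - r) (w - t) (fun u => if ∀ i, ν < u i then 1 / ∏ i, u i else 0) := by
  rw [Finset.sum_congr rfl (g := fun _ => ∫ t in Set.Ioc 0 w,
        sliceIntegral r t (fun v => if ∀ i, ν < v i then g r v / ∏ i, v i else 0) *
          sliceIntegral (k - r) (w - t) (fun u => if ∀ i, ν < u i then 1 / ∏ i, u i else 0))]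
  · rw [Finset.sum_const, Finset.card_powersetCard, Finset.card_univ, Fintype.card_fin, nsmul_eq_mul]
  · intro A hA
    have hAr : A.card = r := (Finset.mem_powersetCard.1 hA).2
    subst hAr
    exact sliceIntegral_subvector_term' hr hrk hν w (g A.card) hgm hC hgb A rfl

/-- `sliceIntegral_box_starSum` with hypotheses only in the dimensions `r ≤ k` that occur.
[cite: FordMaynard2024PrimeSieves, Definition 7.1 and Theorem 7.3 (a)] -/
theorem sliceIntegral_box_starSum' (k : ℕ) {ν : ℝ} (hν : 0 < ν) (w : ℝ) (g : VecFn)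
    (hgm : ∀ r, r ≤ k → Measurable (g r)) {C : ℝ} (hC : 0 ≤ C) (hgb : ∀ r, r ≤ k → ∀ x, |g r x| ≤ C) :
    sliceIntegral k w (fun x => if ∀ i, ν < x i then starSum g k x / ∏ i, x i else 0) =
      ∑ A : Finset (Fin k), sliceIntegral k w
        (fun x => if ∀ i, ν < x i then g A.card (fun i => x (A.orderEmbOfFin rfl i)) / ∏ i, x i else 0) := by
  have hcard : ∀ A : Finset (Fin k), A.card ≤ k := fun A => by
    simpa using Finset.card_le_univ A
  unfold starSum
  refine sliceIntegral_box_finset_sum hν w (Finset.univ : Finset (Finset (Fin k)))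
    (fun A x => g A.card (fun i => x (A.orderEmbOfFin rfl i))) (fun A _ => ?_) hC
    (fun A _ x => hgb _ (hcard A) _)
  exact (hgm A.card (hcard A)).comp (measurable_pi_lambda _ fun i => measurable_pi_apply _)

/-! ### Symmetric piecewise-constant `g`: measurability and bounds of each `g_r` -/

/-- Each `g_r` of a symmetric, piecewise-constant-on-the-cone `g` is measurable.
[cite: FordMaynard2024PrimeSieves, Definition 7.2 (sub-class)] -/
theorem measurable_apply_of_cone {g : VecFn} (hs : g.IsSymmetric) (hpc : IsPiecewiseConstOnCone g) (r : ℕ) :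
    Measurable (g r) := by
  obtain ⟨n, Pc, c, hPc, hg⟩ := apply_dim_pieces hs hpc r
  rw [show g r = fun v => ∑ j, if v ∈ Pc j then c j else 0 from funext hg]
  exact Finset.measurable_sum _ fun j _ => Measurable.ite (hPc j).2 measurable_const measurable_const

/-- Each `g_r` of a symmetric, piecewise-constant-on-the-cone `g` is bounded.
[cite: FordMaynard2024PrimeSieves, Definition 7.2 (sub-class)] -/
theorem exists_abs_apply_le_of_cone {g : VecFn} (hs : g.IsSymmetric) (hpc : IsPiecewiseConstOnCone g) (r : ℕ) :
    ∃ C : ℝ, 0 ≤ C ∧ ∀ v, |g r v| ≤ C := by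
  obtain ⟨n, Pc, c, hPc, hg⟩ := apply_dim_pieces hs hpc r
  refine ⟨∑ j, |c j|, Finset.sum_nonneg fun j _ => abs_nonneg _, fun v => ?_⟩
  rw [hg v]
  refine (Finset.abs_sum_le_sum_abs _ _).trans (Finset.sum_le_sum fun j _ => ?_)
  split_ifs <;> simp [abs_nonneg]

/-- A uniform bound for `g_0, …, g_K`. [folklore] -/
theorem exists_abs_apply_le_upto {g : VecFn} (hs : g.IsSymmetric) (hpc : IsPiecewiseConstOnCone g) (K : ℕ) :
    ∃ C : ℝ, 0 ≤ C ∧ ∀ r, r ≤ K → ∀ v, |g r v| ≤ C := by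
  choose C hC0 hC using fun r => exists_abs_apply_le_of_cone hs hpc r
  refine ⟨∑ r ∈ Finset.range (K + 1), C r, Finset.sum_nonneg fun r _ => hC0 r, fun r hr v => ?_⟩
  refine (hC r v).trans ?_
  exact Finset.single_le_sum (fun r _ => hC0 r) (Finset.mem_range.2 (Nat.lt_succ_of_le hr))

/-! ### Permutation invariance of `(𝟙⋆g)` for symmetric `g` (adapted from the skeleton, v19) -/

/-- Transport of the `g`-value of an ordered listing along `B.card = n`. [folklore] -/
theorem apply_orderEmb_cast' (g : VecFn) {k : ℕ} (x : Fin k → ℝ) (B : Finset (Fin k)) {n : ℕ}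
    (h : B.card = n) :
    g n (fun i => x (B.orderEmbOfFin h i)) = g B.card (fun i => x (B.orderEmbOfFin rfl i)) := by
  subst h; rfl

/-- For symmetric `g`, the value on `x` listed along ANY injective enumeration of `B` is the value along the
increasing one. [cite: FordMaynard2024PrimeSieves, Definition 6.1] -/
theorem apply_comp_eq_of_range' {g : VecFn} (hs : g.IsSymmetric) {k : ℕ} (x : Fin k → ℝ)
    (B : Finset (Fin k)) {n : ℕ} (hB : B.card = n) (f : Fin n → Fin k)
    (hf : Function.Injective f) (hmem : ∀ i, f i ∈ B) :
    g n (x ∘ f) = g n (fun i => x (B.orderEmbOfFin hB i)) := by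
  -- adapted from Lines/sieve_decomposition.lean (`apply_comp_eq_of_range`)
  let π₀ : Fin n → Fin n := fun i => (B.orderIsoOfFin hB).symm ⟨f i, hmem i⟩
  have hπ₀ : Function.Injective π₀ := by
    intro i j hij
    have h1 := congrArg (fun t => ((B.orderIsoOfFin hB) t : Fin k)) hij
    simp only [π₀, OrderIso.apply_symm_apply] at h1
    exact hf h1
  let π : Equiv.Perm (Fin n) := Equiv.ofBijective π₀ (Finite.injective_iff_bijective.mp hπ₀)
  have hcomp : (fun i => x (B.orderEmbOfFin hB i)) ∘ ⇑π = x ∘ f := by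
    funext i
    simp only [Function.comp_apply, π, Equiv.ofBijective_apply, π₀]
    rw [← Finset.coe_orderIsoOfFin_apply, OrderIso.apply_symm_apply]
  rw [← hcomp, hs n π]

/-- **`(𝟙⋆g)(x ∘ σ) = (𝟙⋆g)(x)` for symmetric `g`** (re-index the subsets `A ↦ σ(A)`).
[cite: FordMaynard2024PrimeSieves, Definitions 6.1 and 7.1] -/
theorem starSum_perm' {g : VecFn} (hs : g.IsSymmetric) (k : ℕ) (σ : Equiv.Perm (Fin k))
    (x : Fin k → ℝ) : starSum g k (x ∘ σ) = starSum g k x := by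
  -- adapted from Lines/sieve_decomposition.lean (`starSum_perm`)
  unfold starSum
  rw [← Equiv.sum_comp (Equiv.finsetCongr σ)
    (fun B : Finset (Fin k) => g B.card (fun i => x (B.orderEmbOfFin rfl i)))]
  refine Finset.sum_congr rfl fun A _ => ?_
  have hB : ((Equiv.finsetCongr σ) A).card = A.card := by
    simp only [Equiv.finsetCongr_apply, Finset.card_map]
  have hmem : ∀ i, (⇑σ ∘ ⇑(A.orderEmbOfFin rfl)) i ∈ (Equiv.finsetCongr σ) A := by
    intro i
    simp only [Function.comp_apply, Equiv.finsetCongr_apply, Finset.mem_map_equiv,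
      Equiv.symm_apply_apply]
    exact A.orderEmbOfFin_mem rfl i
  have key := apply_comp_eq_of_range' hs x ((Equiv.finsetCongr σ) A) hB
    (⇑σ ∘ ⇑(A.orderEmbOfFin rfl)) (σ.injective.comp (A.orderEmbOfFin rfl).injective) hmem
  rw [apply_orderEmb_cast' g x ((Equiv.finsetCongr σ) A) hB] at key
  exact key

/-! ### The ordered box-slice of `(𝟙⋆g)/∏` is `1/k!` of the unordered one -/

/-- `starSum g k` of a symmetric piecewise-constant `g` is measurable. [cite: FordMaynard2024PrimeSieves, Definition 7.1] -/
theorem measurable_starSum_of_cone {g : VecFn} (hs : g.IsSymmetric) (hpc : IsPiecewiseConstOnCone g) (k : ℕ) :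
    Measurable (starSum g k) := by
  unfold starSum
  exact Finset.measurable_sum _ fun A _ =>
    (measurable_apply_of_cone hs hpc A.card).comp (measurable_pi_lambda _ fun i => measurable_pi_apply _)

/-- `starSum g k` of a symmetric piecewise-constant `g` is bounded. [cite: FordMaynard2024PrimeSieves, Definition 7.1] -/
theorem exists_abs_starSum_le_of_cone {g : VecFn} (hs : g.IsSymmetric) (hpc : IsPiecewiseConstOnCone g) (k : ℕ) :
    ∃ S : ℝ, 0 ≤ S ∧ ∀ v : Fin k → ℝ, |starSum g k v| ≤ S := by
  obtain ⟨C, hC0, hC⟩ := exists_abs_apply_le_upto hs hpc k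
  refine ⟨∑ _A : Finset (Fin k), C, Finset.sum_nonneg fun _ _ => hC0, fun v => ?_⟩
  unfold starSum
  refine (Finset.abs_sum_le_sum_abs _ _).trans (Finset.sum_le_sum fun A _ => hC _ ?_ _)
  simpa using Finset.card_le_univ A

/-- **Ordered vs unordered**: for symmetric piecewise-constant `g` and `ν > 0`,
`∫_{|x|=w} 𝟙[xᵢ > ν, x monotone] (𝟙⋆g)(x)/∏ xᵢ = (1/k!) ∫_{|x|=w} 𝟙[xᵢ > ν] (𝟙⋆g)(x)/∏ xᵢ`.
[cite: FordMaynard2024PrimeSieves, Theorem 7.3 (a) (ordered integration) with Definition 7.1] -/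
theorem sliceIntegral_box_mono_starSum (k : ℕ) {ν : ℝ} (hν : 0 < ν) (w : ℝ) {g : VecFn} (hs : g.IsSymmetric)
    (hpc : IsPiecewiseConstOnCone g) :
    sliceIntegral k w (fun x => if (∀ i, ν < x i) ∧ Monotone x then starSum g k x / ∏ i, x i else 0) =
      (1 / (k.factorial : ℝ)) *
        sliceIntegral k w (fun x => if ∀ i, ν < x i then starSum g k x / ∏ i, x i else 0) := by
  obtain ⟨S, hS0, hS⟩ := exists_abs_starSum_le_of_cone hs hpc k
  have hsymm := chamber_symm' k w (S / ν ^ k)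
    (fun x => if ∀ i, ν < x i then starSum g k x / ∏ i, x i else 0)
    (measurable_boxIntegrand ν (measurable_starSum_of_cone hs hpc k))
    (fun x => abs_boxIntegrand_le hν hS0 hS x) (fun σ u => ?_)
  · rw [hsymm, one_div, ← mul_assoc, inv_mul_cancel₀ (by positivity), one_mul]
    congr 1
    funext x
    by_cases hm : Monotone x
    · by_cases hb : ∀ i, ν < x i
      · rw [if_pos ⟨hb, hm⟩, if_pos hm, if_pos hb]
      · rw [if_neg (fun h => hb h.1), if_pos hm, if_neg hb]
    · rw [if_neg (fun h => hm h.2), if_neg hm]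
  · -- permutation invariance of the box integrand
    have hiff : (∀ i, ν < (u ∘ σ) i) ↔ ∀ i, ν < u i :=
      ⟨fun h i => by simpa using h (σ.symm i), fun h i => h _⟩
    have hprod : ∏ i, (u ∘ σ) i = ∏ i, u i := Equiv.prod_comp σ u
    simp only [hiff, hprod, starSum_perm' hs k σ u]

/-! ### On the slice `|x| = 1`, `ℋ_k` is the box `xᵢ > ν` -/

/-- On the slice `|x| = 1` with `k ≥ 2` positive coordinates, if all `xⱼ > ν` then every `xᵢ < 1 − ν`
(Lemma 8.4: `ℋ(P) ∩ ℝ^k = {|x| = 1, ν < xᵢ < 1 − ν}`; the upper bounds are automatic for `k ≥ 2`).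
[cite: FordMaynard2024PrimeSieves, Lemma 8.4] -/
theorem upper_lt_of_box_slice {k : ℕ} (hk : 2 ≤ k) {ν : ℝ} {x : Fin k → ℝ} (hbox : ∀ i, ν < x i)
    (hpos : ∀ i, 0 < x i) (hsum : ∑ i, x i = 1) (i : Fin k) : x i < 1 - ν := by
  obtain ⟨j, hj⟩ : ∃ j : Fin k, j ≠ i := by
    by_cases hi : (i : ℕ) = 0
    · exact ⟨⟨1, by omega⟩, fun h => by have := congrArg Fin.val h; simp [hi] at this⟩
    · exact ⟨⟨0, by omega⟩, fun h => by have := congrArg Fin.val h; simp at this; omega⟩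
  have hpair : x i + x j ≤ ∑ l, x l := by
    rw [← Finset.sum_pair hj.symm]
    exact Finset.sum_le_sum_of_subset_of_nonneg (Finset.subset_univ _) fun l _ _ => (hpos l).le
  have := hbox j
  linarith

/-- **`sieveBoundG1` with the box in place of `ℋ_k`**: for `ν > 0`,
`V(ν, g) = 1 + ∑_{k=2}^{⌊1/ν⌋} ∫_{|x|=1} 𝟙[xᵢ > ν ∀ i, x monotone] (𝟙⋆g)(x)/∏ xᵢ` (any real `ν`).
[cite: FordMaynard2024PrimeSieves, Theorem 7.3 (a) and Lemma 8.4] -/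
theorem sieveBoundG1_eq_box (ν : ℝ) (g : VecFn) :
    sieveBoundG1 ν g = 1 + ∑ k ∈ Icc 2 ⌊1 / ν⌋₊,
      sliceIntegral k 1 (fun x => if (∀ i, ν < x i) ∧ Monotone x then starSum g k x / ∏ i, x i else 0) := by
  unfold sieveBoundG1
  congr 1
  refine Finset.sum_congr rfl fun k hk => ?_
  have hk2 : 2 ≤ k := (Finset.mem_Icc.1 hk).1
  refine sliceIntegral_congr fun v hvpos hvsum => ?_
  have hiff : ((∀ i, ν < v i ∧ v i < 1 - ν) ∧ Monotone v) ↔ ((∀ i, ν < v i) ∧ Monotone v) := by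
    constructor
    · rintro ⟨h, hm⟩; exact ⟨fun i => (h i).1, hm⟩
    · rintro ⟨h, hm⟩; exact ⟨fun i => ⟨h i, upper_lt_of_box_slice hk2 h hvpos hvsum i⟩, hm⟩
  simp only [hiff]

/-- **Kernel normal form, step 1: `V(ν, g)` as a sum of subvector terms.** For symmetric `g` piecewise constant
on the ordered cone and `ν > 0`,
`V(ν, g) = 1 + ∑_{k=2}^{⌊1/ν⌋} (1/k!) ∑_{A ⊆ [k]} ∫_{|x| = 1} 𝟙[xᵢ > ν] g_{|A|}(x_A)/∏ xᵢ`;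
each `A`-term is then evaluated by `sliceIntegral_empty_term` (`|A| = 0`), `sum_subvector_terms_card` /
`sliceIntegral_subvector_term'` (`1 ≤ |A| ≤ k−1`: one-dimensional kernel integrals), and vanishes for `A = [k]`
under the support clause `|y| ≤ 1/2` of `𝒢₁`. [cite: FordMaynard2024PrimeSieves, Theorem 7.3 (a), Definition 7.1, Lemma 8.4] -/
theorem sieveBoundG1_eq_sum_subvector_terms {ν : ℝ} (hν : 0 < ν) {g : VecFn} (hs : g.IsSymmetric)
    (hpc : IsPiecewiseConstOnCone g) :
    sieveBoundG1 ν g = 1 + ∑ k ∈ Icc 2 ⌊1 / ν⌋₊, (1 / (k.factorial : ℝ)) *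
      ∑ A : Finset (Fin k), sliceIntegral k 1
        (fun x => if ∀ i, ν < x i then g A.card (fun i => x (A.orderEmbOfFin rfl i)) / ∏ i, x i else 0) := by
  rw [sieveBoundG1_eq_box ν g]
  congr 1
  refine Finset.sum_congr rfl fun k _ => ?_
  rw [sliceIntegral_box_mono_starSum k hν 1 hs hpc]
  congr 1
  obtain ⟨C, hC0, hC⟩ := exists_abs_apply_le_upto hs hpc k
  exact sliceIntegral_box_starSum' k hν 1 g (fun r _ => measurable_apply_of_cone hs hpc r) hC0 hC

/-! ### Kernel normal form under the support clause of `𝒢₁` -/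

/-- The full-vector term vanishes on the slice `|x| = 1` under the support clause `|y| ≤ 1/2` (`k ≥ 1`).
[cite: FordMaynard2024PrimeSieves, (7.1) (support of 𝒢₁) and Theorem 7.3 (a)] -/
theorem sliceIntegral_univ_term_eq_zero {k : ℕ} (hk : 1 ≤ k) {ν : ℝ} (g : VecFn)
    (hsupp : ∀ (r : ℕ) (y : Fin r → ℝ), g r y ≠ 0 → r = 0 ∨ ((∀ i, ν < y i) ∧ ∑ i, y i ≤ 1 / 2)) :
    sliceIntegral k 1 (fun x => if ∀ i, ν < x i then
        g (Finset.univ : Finset (Fin k)).card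
          (fun i => x ((Finset.univ : Finset (Fin k)).orderEmbOfFin rfl i)) / ∏ i, x i else 0) = 0 := by
  have h : sliceIntegral k 1 (fun x => if ∀ i, ν < x i then
      g (Finset.univ : Finset (Fin k)).card
        (fun i => x ((Finset.univ : Finset (Fin k)).orderEmbOfFin rfl i)) / ∏ i, x i else 0) =
      sliceIntegral k 1 (fun _ => 0) := by
    refine sliceIntegral_congr fun x _ hxs => ?_
    split_ifs with hx
    · have hzero : g (Finset.univ : Finset (Fin k)).card
          (fun i => x ((Finset.univ : Finset (Fin k)).orderEmbOfFin rfl i)) = 0 := by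
        by_contra hne
        rcases hsupp _ _ hne with h0 | ⟨-, hsum⟩
        · rw [Finset.card_univ, Fintype.card_fin] at h0; omega
        · have hbij : Function.Bijective ((Finset.univ : Finset (Fin k)).orderEmbOfFin rfl) :=
            (Fintype.bijective_iff_injective_and_card _).mpr
              ⟨((Finset.univ : Finset (Fin k)).orderEmbOfFin rfl).injective, by simp⟩
          have hs : ∑ i, x ((Finset.univ : Finset (Fin k)).orderEmbOfFin rfl i) = ∑ j, x j :=
            Fintype.sum_bijective _ hbij _ _ (fun i => rfl)
          rw [hs, hxs] at hsum
          norm_num at hsum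
      rw [hzero, zero_div]
    · rfl
  rw [h, sliceIntegral_zero]

/-- **Kernel normal form of the certificate value.** For `ν > 0` and a symmetric `g`, piecewise constant on the
ordered cone, with the support clause of `𝒢₁` (`g_r(y) ≠ 0 ⇒ r = 0 ∨ (yᵢ > ν ∀ i ∧ |y| ≤ 1/2)`):

`V(ν, g) = 1 + ∑_{k=2}^{⌊1/ν⌋} (1/k!) · ( g(∅)·F_k(1) + ∑_{r=1}^{k−1} C(k,r) ∫_{t ∈ (0,1]} S_r(t)·F_{k−r}(1 − t) dt )`

with the cone data's slice functions `S_r(t) = ∫_{|v| = t} 𝟙[vᵢ > ν] g_r(v)/∏ vᵢ` (for `r = 1`: `𝟙[t>ν] g₁(t)/t`;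
for `r = 2`: sums of logarithms for piecewise-constant `g₂`, `kernel_two_window_eq_log`) and the universal kernels
`F_m(s) = ∫_{|u| = s} 𝟙[uⱼ > ν]/∏ uⱼ` (`kernel_one`, `kernelTwo_eq_log`, recursion `kernel_succ`): every
`k`-dimensional integral of Theorem 7.3 (a) is a ONE-dimensional integral against tabulable kernels.
[cite: FordMaynard2024PrimeSieves, Theorem 7.3 (a) with Definition 7.1, (7.1), Lemma 8.4, §4.2] -/
theorem sieveBoundG1_eq_kernelForm {ν : ℝ} (hν : 0 < ν) {g : VecFn} (hs : g.IsSymmetric)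
    (hpc : IsPiecewiseConstOnCone g)
    (hsupp : ∀ (r : ℕ) (y : Fin r → ℝ), g r y ≠ 0 → r = 0 ∨ ((∀ i, ν < y i) ∧ ∑ i, y i ≤ 1 / 2)) :
    sieveBoundG1 ν g = 1 + ∑ k ∈ Icc 2 ⌊1 / ν⌋₊, (1 / (k.factorial : ℝ)) *
      (g 0 Fin.elim0 * sliceIntegral k 1 (fun u => if ∀ i, ν < u i then 1 / ∏ i, u i else 0) +
        ∑ r ∈ Ico 1 k, (k.choose r : ℝ) * ∫ t in Set.Ioc 0 1,
          sliceIntegral r t (fun v => if ∀ i, ν < v i then g r v / ∏ i, v i else 0) *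
            sliceIntegral (k - r) (1 - t) (fun u => if ∀ i, ν < u i then 1 / ∏ i, u i else 0)) := by
  rw [sieveBoundG1_eq_sum_subvector_terms hν hs hpc]
  congr 1
  refine Finset.sum_congr rfl fun k hk => ?_
  have hk2 : 2 ≤ k := (Finset.mem_Icc.1 hk).1
  congr 1
  -- group the subsets `A ⊆ [k]` by cardinality
  set T : Finset (Fin k) → ℝ := fun A => sliceIntegral k 1
    (fun x => if ∀ i, ν < x i then g A.card (fun i => x (A.orderEmbOfFin rfl i)) / ∏ i, x i else 0) with hT
  have hgroup : ∑ A : Finset (Fin k), T A =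
      ∑ r ∈ Finset.range (k + 1), ∑ A ∈ Finset.powersetCard r (Finset.univ : Finset (Fin k)), T A := by
    rw [← Finset.powerset_univ, Finset.sum_powerset, Finset.card_univ, Fintype.card_fin]
  rw [hgroup, Finset.sum_range_succ, Finset.sum_range_eq_add_Ico _ (by omega)]
  -- `r = 0`: the empty subvector
  have h0 : ∑ A ∈ Finset.powersetCard 0 (Finset.univ : Finset (Fin k)), T A =
      g 0 Fin.elim0 * sliceIntegral k 1 (fun u => if ∀ i, ν < u i then 1 / ∏ i, u i else 0) := by
    rw [Finset.powersetCard_zero, Finset.sum_singleton, hT]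
    exact sliceIntegral_empty_term k ν 1 g
  -- `r = k`: the full vector, killed by the support clause
  have hk : ∑ A ∈ Finset.powersetCard k (Finset.univ : Finset (Fin k)), T A = 0 := by
    have hku : (Finset.univ : Finset (Fin k)).card = k := by rw [Finset.card_univ, Fintype.card_fin]
    have hpk := Finset.powersetCard_self (Finset.univ : Finset (Fin k))
    rw [hku] at hpk
    rw [hpk, Finset.sum_singleton, hT]
    exact sliceIntegral_univ_term_eq_zero (by omega) g hsupp
  -- `1 ≤ r ≤ k − 1`: the one-dimensional kernel integrals
  obtain ⟨C, hC0, hC⟩ := exists_abs_apply_le_upto hs hpc k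
  have hmid : ∑ r ∈ Ico 1 k, ∑ A ∈ Finset.powersetCard r (Finset.univ : Finset (Fin k)), T A =
      ∑ r ∈ Ico 1 k, (k.choose r : ℝ) * ∫ t in Set.Ioc 0 1,
        sliceIntegral r t (fun v => if ∀ i, ν < v i then g r v / ∏ i, v i else 0) *
          sliceIntegral (k - r) (1 - t) (fun u => if ∀ i, ν < u i then 1 / ∏ i, u i else 0) := by
    refine Finset.sum_congr rfl fun r hr => ?_
    have hr' := Finset.mem_Ico.1 hr
    exact sum_subvector_terms_card k r hr'.1 (by omega) hν 1 g (measurable_apply_of_cone hs hpc r) hC0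
      (hC r (by omega))
  rw [h0, hk, hmid, add_zero]

end Summit.Parity.GeneralizedHardyLittlewood.FordMaynardSieveConst01651SieveConst01651

end
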